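import Summits.CriticalPhenomena.PercolationContinuityZ3.Theorems.PercNearOneGluingNoHeavyLowerTailQ44PrimedKernels
import Summits.CriticalPhenomena.PercolationContinuityZ3.Theorems.PercNearOneGluingNoHeavyLowerTailFourPointRelabelExchange
import HarnessLib

/-!
# The primed four-point family has two orbits: `S1′`, `Θ(R,R)`, `U′_R` are relabellings of `W′`, `S3′`, `U′`

Support file for crux `stmt-CriticalPhenomena-4575` (master-family programme; Conjecture W / packing `U`), seat `prim-l12-p6` gen 31; memo
`run/shared/lean/prim/prim-l12/FROM-prim-l12-p6-g31-PRIMED-FAMILY.md` §1.  Cells as in `FourPointAtoms.pat4`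
(`0 ⊥, 1 cy, 2 by, 3 bc, 4 ay, 5 ac, 6 ab, 7 bcy, 8 ay|bc, 9 ac|by, 10 acy, 11 ab|cy, 12 aby, 13 abc, 14 abcy`).

The memo unifies every conjectured Z-tight quadratic four-point row into `Θ(π,π′) := U′_{π′} − δ_π ≥ 0` (π, π′ pairings of the terminals,
`U′_π = c₀c₁₄ − e₂(c₈,c₉,c₁₁) − c_π·Σ_{s crossing π} c_s − ½Σ_{s crossing π, t ∈ s} c_s c_{T∖t}`, `δ_P = c₁c₆ − c₀c₁₁`, `δ_Q = c₂c₅ − c₀c₉`,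
`δ_R = c₃c₄ − c₀c₈`): `W′/2 = Θ(P,R)`, `S3′ = Θ(P,P)`, `U′ = U′_P` (the kernels `kerQ44P`, `kerS3P`, `kerUP` of `…Q44PrimedKernels`).  Under a
permutation of the terminals the family is permuted; this file records the transposition `b ↔ y` (which swaps `P = ab|cy` with
`R = ay|bc` and fixes `Q = ac|by`):
* `Q44TopGood.cell_relabel_aycb` — the cells of `(a y c b)` in the cells of `(a,b,c,y)` (pattern bookkeeping, as `cell_relabel_acby`);
* `TwoCopyMono.s1P_cells_of_goodKernel_primed` — **`GoodKernel kerQ44P ⟹ S1′ = S1 − c₈c₉ ≥ 0`** on every finite weighted graph, all `n`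
  (`S1′ = Θ(R,P) = (W′/2)∘(b y)`: `prim-bnk-1` gen 34's row `S1` and Conjecture W are ONE orbit at the level of the primed rows);
* `TwoCopyMono.thetaRR_cells_of_goodKernel_primed` — `GoodKernel kerS3P ⟹ Θ(R,R) = c₀(c₈+c₁₄) − c₃c₄ − e₂ − c₈(c₁+c₂+c₅+c₆) − ½·darts(R) ≥ 0`;
* `TwoCopyMono.uPR_cells_of_goodKernel_primed` — `GoodKernel kerUP ⟹ U′_R ≥ 0` (`U′_R` = half of the `D₈`-invariant part `B` of `W′`; `W′ = 2U′_R − 2δ_P`,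
  `TwoCopyMono.wP_eq_uPR_sub_deltaP`, a ring identity).
No sorries, no named facts, no new definitions; standard axioms.  The hypotheses `GoodKernel _` are the open statements (`ConjWPrime`, …).
-/

noncomputable section

namespace Summit.CriticalPhenomena.PercolationContinuityZ3.Theorems

namespace Q44TopGood

open MeasureTheory Set Literature.Probability.Percolation
open Literature.Probability.LatticeModels (prodBernoulli)
open FourPointAtoms
open Summit.CriticalPhenomena.PercolationContinuityZ3.Cruxes.AdditiveGluing.TieLine.ConnAtoms
open scoped Classical

variable {n : ℕ}

/-- Cells of the relabelled quadruple `(a y c b)` (the transposition `b ↔ y`, which swaps the pairings `ab|cy ↔ ay|bc` and fixes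
`ac|by`) in the cells of `(a,b,c,y)`. [folklore] -/
theorem cell_relabel_aycb (w : Sym2 (Fin n) → unitInterval) (a b c y : Fin n) (i : Fin 15) :
    cell w a y c b i =
      (if (∀ j k : Fin 4, pat4 0 ((![0, 3, 2, 1] : Fin 4 → Fin 4) j) = pat4 0 ((![0, 3, 2, 1] : Fin 4 → Fin 4) k) ↔ pat4 i j = pat4 i k) then cell w a b c y 0 else 0) +
      (if (∀ j k : Fin 4, pat4 1 ((![0, 3, 2, 1] : Fin 4 → Fin 4) j) = pat4 1 ((![0, 3, 2, 1] : Fin 4 → Fin 4) k) ↔ pat4 i j = pat4 i k) then cell w a b c y 1 else 0) +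
      (if (∀ j k : Fin 4, pat4 2 ((![0, 3, 2, 1] : Fin 4 → Fin 4) j) = pat4 2 ((![0, 3, 2, 1] : Fin 4 → Fin 4) k) ↔ pat4 i j = pat4 i k) then cell w a b c y 2 else 0) +
      (if (∀ j k : Fin 4, pat4 3 ((![0, 3, 2, 1] : Fin 4 → Fin 4) j) = pat4 3 ((![0, 3, 2, 1] : Fin 4 → Fin 4) k) ↔ pat4 i j = pat4 i k) then cell w a b c y 3 else 0) +
      (if (∀ j k : Fin 4, pat4 4 ((![0, 3, 2, 1] : Fin 4 → Fin 4) j) = pat4 4 ((![0, 3, 2, 1] : Fin 4 → Fin 4) k) ↔ pat4 i j = pat4 i k) then cell w a b c y 4 else 0) +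
      (if (∀ j k : Fin 4, pat4 5 ((![0, 3, 2, 1] : Fin 4 → Fin 4) j) = pat4 5 ((![0, 3, 2, 1] : Fin 4 → Fin 4) k) ↔ pat4 i j = pat4 i k) then cell w a b c y 5 else 0) +
      (if (∀ j k : Fin 4, pat4 6 ((![0, 3, 2, 1] : Fin 4 → Fin 4) j) = pat4 6 ((![0, 3, 2, 1] : Fin 4 → Fin 4) k) ↔ pat4 i j = pat4 i k) then cell w a b c y 6 else 0) +
      (if (∀ j k : Fin 4, pat4 7 ((![0, 3, 2, 1] : Fin 4 → Fin 4) j) = pat4 7 ((![0, 3, 2, 1] : Fin 4 → Fin 4) k) ↔ pat4 i j = pat4 i k) then cell w a b c y 7 else 0) +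
      (if (∀ j k : Fin 4, pat4 8 ((![0, 3, 2, 1] : Fin 4 → Fin 4) j) = pat4 8 ((![0, 3, 2, 1] : Fin 4 → Fin 4) k) ↔ pat4 i j = pat4 i k) then cell w a b c y 8 else 0) +
      (if (∀ j k : Fin 4, pat4 9 ((![0, 3, 2, 1] : Fin 4 → Fin 4) j) = pat4 9 ((![0, 3, 2, 1] : Fin 4 → Fin 4) k) ↔ pat4 i j = pat4 i k) then cell w a b c y 9 else 0) +
      (if (∀ j k : Fin 4, pat4 10 ((![0, 3, 2, 1] : Fin 4 → Fin 4) j) = pat4 10 ((![0, 3, 2, 1] : Fin 4 → Fin 4) k) ↔ pat4 i j = pat4 i k) then cell w a b c y 10 else 0) +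
      (if (∀ j k : Fin 4, pat4 11 ((![0, 3, 2, 1] : Fin 4 → Fin 4) j) = pat4 11 ((![0, 3, 2, 1] : Fin 4 → Fin 4) k) ↔ pat4 i j = pat4 i k) then cell w a b c y 11 else 0) +
      (if (∀ j k : Fin 4, pat4 12 ((![0, 3, 2, 1] : Fin 4 → Fin 4) j) = pat4 12 ((![0, 3, 2, 1] : Fin 4 → Fin 4) k) ↔ pat4 i j = pat4 i k) then cell w a b c y 12 else 0) +
      (if (∀ j k : Fin 4, pat4 13 ((![0, 3, 2, 1] : Fin 4 → Fin 4) j) = pat4 13 ((![0, 3, 2, 1] : Fin 4 → Fin 4) k) ↔ pat4 i j = pat4 i k) then cell w a b c y 13 else 0) +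
      (if (∀ j k : Fin 4, pat4 14 ((![0, 3, 2, 1] : Fin 4 → Fin 4) j) = pat4 14 ((![0, 3, 2, 1] : Fin 4 → Fin 4) k) ↔ pat4 i j = pat4 i k) then cell w a b c y 14 else 0) := by
  unfold cell; rw [measureReal_eq_cellSum w a b c y (hasPattern_atom_perm (![0, 3, 2, 1] : Fin 4 → Fin 4) a b c y (q' := quad a y c b)
    (by intro j; fin_cases j <;> rfl) (pat4 i))]; rfl

end Q44TopGood

namespace TwoCopyMono

open FourPointAtoms Q44TopGood

variable {n : ℕ}

/-- **`S1′ ≥ 0` from Conjecture W′** (`S1′ = (W′/2)∘(b y)`): if `kerQ44P` is a good kernel then on every finite weighted graph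
`2c₃c₄ + 2e₂(c₈,c₉,c₁₁) + 2c₁₁(c₂+c₃+c₄+c₅) + darts(P) ≤ 2c₀(c₈+c₁₄)`. [this work] -/
theorem s1P_cells_of_goodKernel_primed (hK : GoodKernel kerQ44P) (w : Sym2 (Fin n) → unitInterval) (a b c y : Fin n) :
    2 * (cell w a b c y 3 * cell w a b c y 4) + 2 * (cell w a b c y 8 * cell w a b c y 9 + cell w a b c y 8 * cell w a b c y 11 + cell w a b c y 9 * cell w a b c y 11) +
      2 * (cell w a b c y 11 * (cell w a b c y 2 + cell w a b c y 3 + cell w a b c y 4 + cell w a b c y 5)) +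
      (cell w a b c y 2 * (cell w a b c y 10 + cell w a b c y 13) + cell w a b c y 3 * (cell w a b c y 10 + cell w a b c y 12) + cell w a b c y 4 * (cell w a b c y 7 + cell w a b c y 13) + cell w a b c y 5 * (cell w a b c y 7 + cell w a b c y 12)) ≤
      2 * (cell w a b c y 0 * (cell w a b c y 8 + cell w a b c y 14)) := by
  have h := q44P_cells_of_goodKernel hK w a y c b
  rw [cell_relabel_aycb w a b c y 0, cell_relabel_aycb w a b c y 1, cell_relabel_aycb w a b c y 2, cell_relabel_aycb w a b c y 5, cell_relabel_aycb w a b c y 6, cell_relabel_aycb w a b c y 7, cell_relabel_aycb w a b c y 8, cell_relabel_aycb w a b c y 9, cell_relabel_aycb w a b c y 10, cell_relabel_aycb w a b c y 11, cell_relabel_aycb w a b c y 12, cell_relabel_aycb w a b c y 13, cell_relabel_aycb w a b c y 14] at h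
  simp (config := {decide := true}) only [ite_true, ite_false, zero_add, add_zero] at h
  linarith

/-- **`Θ(R,R) ≥ 0` from Conjecture S3′** (`Θ(R,R) = S3′∘(b y)`): if `kerS3P` is a good kernel then on every finite weighted graph
`2c₃c₄ + 2e₂(c₈,c₉,c₁₁) + 2c₈(c₁+c₂+c₅+c₆) + darts(R) ≤ 2c₀(c₈+c₁₄)`. [this work] -/
theorem thetaRR_cells_of_goodKernel_primed (hK : GoodKernel kerS3P) (w : Sym2 (Fin n) → unitInterval) (a b c y : Fin n) :
    2 * (cell w a b c y 3 * cell w a b c y 4) + 2 * (cell w a b c y 8 * cell w a b c y 9 + cell w a b c y 8 * cell w a b c y 11 + cell w a b c y 9 * cell w a b c y 11) +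
      2 * (cell w a b c y 8 * (cell w a b c y 1 + cell w a b c y 2 + cell w a b c y 5 + cell w a b c y 6)) +
      (cell w a b c y 2 * (cell w a b c y 10 + cell w a b c y 13) + cell w a b c y 1 * (cell w a b c y 12 + cell w a b c y 13) + cell w a b c y 5 * (cell w a b c y 7 + cell w a b c y 12) + cell w a b c y 6 * (cell w a b c y 7 + cell w a b c y 10)) ≤
      2 * (cell w a b c y 0 * (cell w a b c y 8 + cell w a b c y 14)) := by
  have h := packS3P_of_goodKernel hK w a y c b
  rw [cell_relabel_aycb w a b c y 0, cell_relabel_aycb w a b c y 1, cell_relabel_aycb w a b c y 2, cell_relabel_aycb w a b c y 3, cell_relabel_aycb w a b c y 4, cell_relabel_aycb w a b c y 5, cell_relabel_aycb w a b c y 6, cell_relabel_aycb w a b c y 7, cell_relabel_aycb w a b c y 8, cell_relabel_aycb w a b c y 9, cell_relabel_aycb w a b c y 10, cell_relabel_aycb w a b c y 11, cell_relabel_aycb w a b c y 12, cell_relabel_aycb w a b c y 13, cell_relabel_aycb w a b c y 14] at h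
  simp (config := {decide := true}) only [ite_true, ite_false, zero_add, add_zero] at h
  linarith

/-- **`U′_R ≥ 0` from Conjecture U′** (`U′_R = U′∘(b y)`): if `kerUP` is a good kernel then on every finite weighted graph
`2e₂(c₈,c₉,c₁₁) + 2c₈(c₁+c₂+c₅+c₆) + darts(R) ≤ 2c₀c₁₄`. [this work] -/
theorem uPR_cells_of_goodKernel_primed (hK : GoodKernel kerUP) (w : Sym2 (Fin n) → unitInterval) (a b c y : Fin n) :
    2 * (cell w a b c y 8 * cell w a b c y 9 + cell w a b c y 8 * cell w a b c y 11 + cell w a b c y 9 * cell w a b c y 11) + 2 * (cell w a b c y 8 * (cell w a b c y 1 + cell w a b c y 2 + cell w a b c y 5 + cell w a b c y 6)) +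
      (cell w a b c y 2 * (cell w a b c y 10 + cell w a b c y 13) + cell w a b c y 1 * (cell w a b c y 12 + cell w a b c y 13) + cell w a b c y 5 * (cell w a b c y 7 + cell w a b c y 12) + cell w a b c y 6 * (cell w a b c y 7 + cell w a b c y 10)) ≤
      2 * (cell w a b c y 0 * cell w a b c y 14) := by
  have h := packUP_of_goodKernel hK w a y c b
  rw [cell_relabel_aycb w a b c y 0, cell_relabel_aycb w a b c y 2, cell_relabel_aycb w a b c y 3, cell_relabel_aycb w a b c y 4, cell_relabel_aycb w a b c y 5, cell_relabel_aycb w a b c y 7, cell_relabel_aycb w a b c y 8, cell_relabel_aycb w a b c y 9, cell_relabel_aycb w a b c y 10, cell_relabel_aycb w a b c y 11, cell_relabel_aycb w a b c y 12, cell_relabel_aycb w a b c y 13, cell_relabel_aycb w a b c y 14] at h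
  simp (config := {decide := true}) only [ite_true, ite_false, zero_add, add_zero] at h
  linarith

/-- The `D₈` decomposition `W′ = 2U′_R − 2δ_P` as a polynomial identity in the cells (`δ_P = c₁c₆ − c₀c₁₁`). [this work] -/
theorem wP_eq_uPR_sub_deltaP (c : Fin 15 → ℝ) :
    2 * ((c 11 + c 14) * c 0) -
        2 * (c 11 * c 9 + c 11 * c 8 + c 6 * c 8 + c 6 * c 1 + c 1 * c 8) -
          (c 2 * c 13 + c 1 * c 13 + c 5 * c 12 + c 1 * c 12 + c 6 * c 10 + c 6 * c 7 + c 2 * c 10 + c 5 * c 7) -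
            2 * (c 2 * c 8 + c 5 * c 8 + c 8 * c 9) =
      2 * (c 0 * c 14 - (c 8 * c 9 + c 8 * c 11 + c 9 * c 11) - c 8 * (c 1 + c 2 + c 5 + c 6) -
          (c 2 * (c 10 + c 13) + c 1 * (c 12 + c 13) + c 5 * (c 7 + c 12) + c 6 * (c 7 + c 10)) / 2) -
        2 * (c 1 * c 6 - c 0 * c 11) := by
  ring

end TwoCopyMono

end Summit.CriticalPhenomena.PercolationContinuityZ3.Theorems
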